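import Summits.KontsevichZagierPeriods.Zeta5Search.TwoTaleOmega.OmegaRegion
import Summits.KontsevichZagierPeriods.Zeta5Search.Certificates.TwoTaleTelescopeBL
import Summits.KontsevichZagierPeriods.Zeta5Search.TwoTaleOmega.OmegaStepBL

/-!
# (bmiss)@Ω — the recurrence in direction `b`, FIRST TALE (cell `pub-zeta5`, cert-1 gen 4; pilot instance)

HONEST FRAMING: systematic search; recurrence certificates; no irrationality claim unless certified. Pure finite algebra
over `ℚ`; no named fact, no `sorry`.

Blueprint `families/tele/RECURRENCE.md` §13.10–13.12, direction `δ = b = (0,1,0,0,0)`, side `L` (Zudilin's first tale).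
INPUT: cert-2's kernel identity `Certificates.TwoTaleTelescope.telescope_b_L` (the cleared creative-telescoping certificate of
fam-tele gen 3, `certs/tele/bmiss_general/certificates.json`, direction `b`, side `L`: `Cert_L = t(t+a−e)(t+a−f)(t+g−1)`,
`x_L = 1`). OUTPUT (`recL_b`): for a base point `p` with `p, p+δ, p+2δ, p+3δ ∈ Ω`,
  `Σ_{k<4} c^b_k(p) · Λ¹_{node(p+kδ)}[vL(p+kδ)] = 0`  and  `Σ_{k<4} c^b_k(p) · Λ⁰_{node(p+kδ)}[vL(p+kδ)] = 0`
(common truncation `D = d⁺ + 7`), i.e. the first-tale halves of `U1`, `U0` (`OmegaForms`) satisfy the telescoper's recurrence.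
STEPS: (1) Γ-ratios `F_L(p+kδ;t) = (t+b)⋯(t+b+k−1)·F_L(p;t)`, `F_L(p;t+1)·td = F_L(p;t)·tn` (block algebra);
(2) the function identity `Σ c_k F_L(p+kδ;t) = G(t+1) − G(t)`, `G = Cert_L·F_L(p;·)` (`telescope_b_L` + `telescope_assembly`);
(3) `G` as closed-form data `GfBL p = ofFrac [a,g) 1 (N_G)` and the DATA identity by Lemma U (`PF.eq_of_eval_eq_on`);
(4) legitimacy at the common node `s* = 1 − a₂*(e,f,b,a)` = the node of `p` itself: `ρ¹_{s*}(G) = 0` (no pole) and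
`ρ⁰_{s*}(G) = 0` (double zero of `N_G`: two of the blocks `[0,e)`, `[a−e,f)`, `[a−f,b)` contain `a₂*−1` — three Ω-cases by
`omega`, then `PF.rho0_ofFrac_eq_zero`); (5) node moves: `Λ_{node(p+kδ)}[vL(p+kδ)] = Λ_{s*}[vL(p+kδ)]` because
`F_L(p+kδ;·)` has a double zero at every crossed lattice point (`Pt.lam_vL_move`); (6) `FormalBarnesStep.lam•_step`.
The leading coefficient is `c^b_3(p) = 2e+2f+b+1−a−g ≥ 2` on Ω (`coefB_three`, `coefB_three_pos`).
-/

noncomputable section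

open Finset Polynomial
open Literature.NumberTheory.Irrationality.Zudilin2014
open Summit.KontsevichZagierPeriods.Zeta5Search.FormalBarnes
open Summit.KontsevichZagierPeriods.Zeta5Search.Certificates.TwoTaleTelescope

namespace Summit.KontsevichZagierPeriods.Zeta5Search.TwoTaleOmega

namespace Pt

variable (p : Pt)

/-! ### The telescoper of direction `b` at a point -/

/-- cert-2's telescoper coefficients `c^b_0..c^b_3` of direction `b`, evaluated at `p` (packed data of
`Certificates.TwoTaleTelescopeBL`). -/
def coefB : Fin 4 → ℚ :=
  ![spvalC Certificates.TwoTaleTelescope.cB0 (p.a : ℚ) p.b p.e p.f p.g, spvalC Certificates.TwoTaleTelescope.cB1 (p.a : ℚ) p.b p.e p.f p.g,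
    spvalC Certificates.TwoTaleTelescope.cB2 (p.a : ℚ) p.b p.e p.f p.g, spvalC Certificates.TwoTaleTelescope.cB3 (p.a : ℚ) p.b p.e p.f p.g]

/-- The leading coefficient in closed form: `c^b_3(p) = 2e + 2f + b + 1 − a − g`. -/
theorem coefB_three : p.coefB 3 = 2 * p.e + 2 * p.f + p.b + 1 - p.a - p.g := by
  simp [coefB, Certificates.TwoTaleTelescope.cB3, spvalC, spvalN, spval, unpackT]; ring

variable {p}

/-- On Ω the leading coefficient is `≥ 2`, in particular non-zero. -/
theorem coefB_three_pos (h : p.Omega) : 2 ≤ p.coefB 3 := by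
  rw [coefB_three]; have := h.g_le; exact_mod_cast (by omega : (2:ℤ) ≤ 2 * p.e + 2 * p.f + p.b + 1 - p.a - p.g)

/-- The certificate numerator `x_L` of direction `b` is the constant `1`. -/
theorem xBL_eval (s : ℤ) (a b e f g t : ℚ) : polyTN xBL s a b e f g t = 1 := by
  simp [polyTN, xBL, spvalC, spvalN, spval, unpackT]

/-! ### Block algebra along `δ_b` -/

variable (p)

/-- Along `δ_b` the numerator gains the block `(t+b)⋯(t+b+k−1)`: `num(p+kδ) = num(p)·block(b, b+k)` (`k ≥ 0`, `p ∈ Ω`). -/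
theorem num_addB_eq (h : p.Omega) {k : ℤ} (hk : 0 ≤ k) :
    num (p.addB k).t1a (p.addB k).t1b = num p.t1a p.t1b * block p.b (p.b + k) := by
  have hb := h.b_ge; have := h.f_le
  rw [num_t1, num_t1]
  simp only [addB_a, addB_b, addB_e, addB_f]
  rw [← block_mul_block (lo := p.a - p.f + 1) (mi := p.b) (hi := p.b + k) (by omega) (by omega)]
  ring

/-- `block b (b+1) (t) = t+b`, `block b (b+2)(t) = (t+b)(t+b+1)`, `block b (b+3)(t) = (t+b)(t+b+1)(t+b+2)`. -/
theorem eval_block_123 (b : ℤ) (t : ℚ) : (block b (b + 1)).eval t = t + b ∧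
    (block b (b + 2)).eval t = (t + b) * (t + b + 1) ∧
    (block b (b + 3)).eval t = (t + b) * (t + b + 1) * (t + b + 2) := by
  have e1 : block b (b + 1) = lin b := block_single b
  have e2 : block b (b + 2) = lin b * lin (b + 1) := by
    rw [block_succ_left (by omega), show b + 2 = (b + 1) + 1 by ring, block_single]
  have e3 : block b (b + 3) = lin b * (lin (b + 1) * lin (b + 2)) := by
    rw [block_succ_left (by omega), block_succ_left (lo := b + 1) (by omega), show b + 3 = (b + 1 + 1) + 1 by ring,
      block_single, show b + 1 + 1 = b + 2 by ring]
  refine ⟨by rw [e1, eval_lin], by rw [e2, eval_mul, eval_lin, eval_lin]; push_cast; ring,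
    by rw [e3, eval_mul, eval_mul, eval_lin, eval_lin, eval_lin]; push_cast; ring⟩

/-! ### The telescoped function `G = Cert_L · F_L(p;·)` as closed-form data -/

/-- Numerator of `G`: `t(t+a−e)(t+a−f)(t+g−1)·num = block(0,e)·block(a−e,f)·block(a−f,b)·(t+g−1)` (merged blocks). -/
def NfBL : ℚ[X] := block 0 p.e * block (p.a - p.e) p.f * block (p.a - p.f) p.b * lin (p.g - 1)

/-- The merged form equals `Cert_L`'s linear factors times `num` (on Ω the blocks are non-empty). -/
theorem NfBL_eq (h : p.Omega) :
    p.NfBL = lin 0 * lin (p.a - p.e) * lin (p.a - p.f) * lin (p.g - 1) * num p.t1a p.t1b := by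
  obtain ⟨h1, h2, h3, h4, h5, h6, h7, h8, h9⟩ := h
  rw [num_t1, NfBL, block_succ_left (lo := 0) (hi := p.e) (by omega),
    block_succ_left (lo := p.a - p.e) (hi := p.f) (by omega), block_succ_left (lo := p.a - p.f) (hi := p.b) (by omega)]
  ring_nf

/-- Degree of `N_G`: `e + (f−a+e) + (b−a+f) + 1`. -/
theorem natDegree_NfBL :
    p.NfBL.natDegree = (p.e).toNat + (p.f - (p.a - p.e)).toNat + (p.b - (p.a - p.f)).toNat + 1 := by
  unfold NfBL
  rw [natDegree_mul (mul_ne_zero (mul_ne_zero (block_ne_zero _ _) (block_ne_zero _ _)) (block_ne_zero _ _))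
      (monic_lin _).ne_zero,
    natDegree_mul (mul_ne_zero (block_ne_zero _ _) (block_ne_zero _ _)) (block_ne_zero _ _),
    natDegree_mul (block_ne_zero _ _) (block_ne_zero _ _), natDegree_block, natDegree_block, natDegree_block]
  unfold lin; rw [natDegree_X_add_C]; simp

/-- **The telescoped data** `G_{b,L}(p) = ofFrac [a,g) 1 (N_G)`. -/
def GfBL : PF := PF.ofFrac (Ico p.a p.g) (fun _ => 1) p.NfBL

/-- The poles of `G_{b,L}` lie in `[a,g)`. -/
theorem poles_GfBL : p.GfBL.poles ⊆ Ico p.a p.g := PF.poles_ofFrac _ _ _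

/-- Value of `G_{b,L}`: `Cert_L(t)·num(t)/den(t)` off the poles. -/
theorem GfBL_eval (h : p.Omega) {t : ℚ} (ht : ∀ k ∈ Ico p.a p.g, t + k ≠ 0) :
    p.GfBL.eval t = t * (t + (p.a - p.e : ℤ)) * (t + (p.a - p.f : ℤ)) * (t + (p.g - 1 : ℤ))
      * ((num p.t1a p.t1b).eval t / (den p.t1a p.t1b).eval t) := by
  unfold GfBL
  rw [PF.eval_ofFrac _ _ _ (fun _ _ => Or.inl rfl) ht, denom_Ico_one, NfBL_eq p h, den_t1]
  simp only [eval_mul, eval_lin]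
  push_cast; ring

/-- Degree of the polynomial part of `G_{b,L}`: `d + 4 ≤ d⁺ + 7`. -/
theorem natDegree_GfBL_le (h : p.Omega) : p.GfBL.poly.natDegree ≤ dExp p.t1a p.t1b + 7 := by
  unfold GfBL
  rw [PF.natDegree_ofFrac, natDegree_NfBL p, sum_const, Int.card_Ico, smul_eq_mul, mul_one]
  unfold dExp; rw [sum_t1a_sub_sum_t1b]; unfold dInt
  obtain ⟨h1, h2, h3, h4, h5, h6, h7, h8, h9⟩ := h
  omega

/-! ### Step (2): the function identity -/

/-- The exceptional set for Lemma U: the poles of both sides and of the shifted data, and the zeros of `td`. -/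
def SbL : Finset ℤ := Ico (p.a - 1) (p.g + 1) ∪ {1, p.a - p.e + 1, p.a - p.f + 1}

variable {p}

set_option maxRecDepth 16384 in
set_option maxHeartbeats 2000000 in
/-- **Function identity** `Σ_k c^b_k(p) F_L(p+kδ;t) = G(t+1) − G(t)` off the exceptional set. -/
theorem funId_bL (h0 : p.Omega) (h1 : (p.addB 1).Omega) (h2 : (p.addB 2).Omega) (h3 : (p.addB 3).Omega) {t : ℚ}
    (ht : ∀ k ∈ p.SbL, t + k ≠ 0) :
    p.coefB 0 * p.vL.eval t + p.coefB 1 * (p.addB 1).vL.eval t + p.coefB 2 * (p.addB 2).vL.eval t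
      + p.coefB 3 * (p.addB 3).vL.eval t = p.GfBL.eval (t + 1) - p.GfBL.eval t := by
  have o := h0
  obtain ⟨o1, o2, o3, o4, o5, o6, o7, o8, o9⟩ := h0
  have hS : ∀ k ∈ Ico p.a p.g, t + k ≠ 0 := fun k hk => ht k (by
    unfold SbL; rw [mem_union]; left; rw [mem_Ico] at hk ⊢; omega)
  have hS1 : ∀ k ∈ Ico p.a p.g, t + 1 + k ≠ 0 := fun k hk => by
    have := ht (k + 1) (by unfold SbL; rw [mem_union]; left; rw [mem_Ico] at hk ⊢; omega)
    push_cast at this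
    rwa [add_assoc, add_comm (1:ℚ)]
  have hg : t + p.g ≠ 0 := ht p.g (by unfold SbL; rw [mem_union]; left; rw [mem_Ico]; omega)
  have h1' : t + 1 ≠ 0 := by
    have := ht 1 (by unfold SbL; rw [mem_union]; right; simp)
    push_cast at this; exact this
  have hae : t + (p.a - p.e + 1 : ℤ) ≠ 0 := ht _ (by unfold SbL; rw [mem_union]; right; simp)
  have haf : t + (p.a - p.f + 1 : ℤ) ≠ 0 := ht _ (by unfold SbL; rw [mem_union]; right; simp)
  -- the four values and the shift
  set F0 := p.vL.eval t with hF0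
  have eN : (num p.t1a p.t1b).eval t / (den p.t1a p.t1b).eval t = F0 := (vL_eval_w o hS).symm
  have e123 := eval_block_123 p.b t
  have eF1 : (p.addB 1).vL.eval t = (t + p.b) * F0 := by
    rw [vL_eval_w h1 hS, num_addB_eq p o (by norm_num), den_addB, eval_mul, e123.1, ← eN]; ring
  have eF2 : (p.addB 2).vL.eval t = (t + p.b) * (t + p.b + 1) * F0 := by
    rw [vL_eval_w h2 hS, num_addB_eq p o (by norm_num), den_addB, eval_mul, e123.2.1, ← eN]; ring
  have eF3 : (p.addB 3).vL.eval t = (t + p.b) * (t + p.b + 1) * (t + p.b + 2) * F0 := by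
    rw [vL_eval_w h3 hS, num_addB_eq p o (by norm_num), den_addB, eval_mul, e123.2.2, ← eN]; ring
  have hshift := vL_shift o hS hS1
  rw [← hF0] at hshift
  set F0' := p.vL.eval (t + 1) with hF0'
  -- the values of G
  have eG0 : p.GfBL.eval t = t * (t + (p.a - p.e : ℤ)) * (t + (p.a - p.f : ℤ)) * (t + (p.g - 1 : ℤ)) * F0 := by
    rw [GfBL_eval p o hS, eN]
  have eG1 : p.GfBL.eval (t + 1)
      = (t + 1) * (t + 1 + (p.a - p.e : ℤ)) * (t + 1 + (p.a - p.f : ℤ)) * (t + 1 + (p.g - 1 : ℤ)) * F0' := by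
    rw [GfBL_eval p o hS1, hF0', vL_eval_w o hS1]
  -- cert-2's cleared identity, with its atoms evaluated
  have hc := telescope_b_L (p.a : ℚ) p.b p.e p.f p.g t
  simp only [lprod_cons, lprod_nil, lval, numBL0, numBL1, numBL2, numBL3, denBL0, denBL1, denBL2, denBL3, tnBL, tdBL,
    cnumBL, cnumSBL, cdenBL, cdenSBL, List.getD_cons_zero, List.getD_cons_succ, xBL_eval] at hc
  push_cast at hc
  have c0 : p.coefB 0 = spvalC Certificates.TwoTaleTelescope.cB0 (p.a : ℚ) p.b p.e p.f p.g := rfl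
  have c1 : p.coefB 1 = spvalC Certificates.TwoTaleTelescope.cB1 (p.a : ℚ) p.b p.e p.f p.g := rfl
  have c2 : p.coefB 2 = spvalC Certificates.TwoTaleTelescope.cB2 (p.a : ℚ) p.b p.e p.f p.g := rfl
  have c3 : p.coefB 3 = spvalC Certificates.TwoTaleTelescope.cB3 (p.a : ℚ) p.b p.e p.f p.g := rfl
  rw [c0, c1, c2, c3, eF1, eF2, eF3, eG0, eG1]
  have htd : (t + 1) * (t + (p.a - p.e + 1 : ℤ)) * (t + (p.a - p.f + 1 : ℤ)) * (t + p.g) ≠ 0 :=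
    mul_ne_zero (mul_ne_zero (mul_ne_zero h1' hae) haf) hg
  refine mul_right_cancel₀ htd ?_
  push_cast at hshift ⊢
  linear_combination F0 * hc
    - ((t + 1) * (t + 1 + (p.a - p.e)) * (t + 1 + (p.a - p.f)) * (t + 1 + (p.g - 1))) * hshift

/-! ### Step (3): the DATA identity -/

/-- **Data identity** `Σ_k c^b_k(p)·vL(p+kδ) = S G − G` (Lemma U over the exceptional set `SbL`). -/
theorem dataId_bL (h0 : p.Omega) (h1 : (p.addB 1).Omega) (h2 : (p.addB 2).Omega) (h3 : (p.addB 3).Omega) :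
    PF.comb4 p.coefB ![p.vL, (p.addB 1).vL, (p.addB 2).vL, (p.addB 3).vL] = p.GfBL.shift.add (p.GfBL.smul (-1)) := by
  have hIco : Ico p.a p.g ⊆ p.SbL := fun k hk => by
    unfold SbL; rw [mem_union]; left; rw [mem_Ico] at hk ⊢; omega
  have hvk : ∀ q : Pt, q.Omega → q.a = p.a → q.g = p.g → q.vL.poles ⊆ p.SbL := fun q hq hqa hqg => by
    refine (poles_vL q).trans (Subset.trans (Ico_subset_Ico ?_ ?_) hIco)
    · rw [amax_t1a_eq, hqa]; have := hq.e_le; have := hq.f_le; omega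
    · rw [hqg]
  refine PF.eq_of_eval_eq_on _ _ p.SbL ?_ ?_ fun t ht => ?_
  · refine (PF.poles_comb4_subset _ _).trans (union_subset (union_subset ?_ ?_) (union_subset ?_ ?_)) <;>
      simp only [Matrix.cons_val_zero, Matrix.cons_val_one, Matrix.cons_val_two, Matrix.cons_val_three,
        Matrix.head_cons, Matrix.tail_cons]
    · exact hvk p h0 rfl rfl
    · exact hvk _ h1 rfl rfl
    · exact hvk _ h2 rfl rfl
    · exact hvk _ h3 rfl rfl
  · refine (PF.poles_shift_sub_subset _).trans (union_subset ?_ ((poles_GfBL p).trans hIco))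
    intro k hk
    obtain ⟨j, hj, rfl⟩ := mem_image.1 hk
    have hj' := poles_GfBL p hj
    unfold SbL; rw [mem_union]; left; rw [mem_Ico] at hj' ⊢; omega
  · rw [PF.eval_comb4, PF.eval_shift_sub, Fin.sum_univ_four]
    simp only [Matrix.cons_val_zero, Matrix.cons_val_one, Matrix.cons_val_two, Matrix.cons_val_three,
      Matrix.head_cons, Matrix.tail_cons]
    exact funId_bL h0 h1 h2 h3 ht

/-! ### Step (4): legitimacy at the common node `s* = node(p)` -/

/-- The common node is not a pole and `N_G` has a double zero there: `ρ⁰_{s*}(G) = ρ¹_{s*}(G) = 0`. -/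
theorem GfBL_rho (h : p.Omega) : rho0 p.nodeL p.GfBL = 0 ∧ rho1 p.nodeL p.GfBL = 0 := by
  have sp := a2star_t1a_eq h
  obtain ⟨o1, o2, o3, o4, o5, o6, o7, o8, o9⟩ := h
  set m := a2star p.t1a with hm
  have hnode : p.nodeL = -(m - 1) := by unfold nodeL; ring
  have hc : m - 1 ∉ Ico p.a p.g := by rw [mem_Ico]; omega
  rw [hnode]
  refine ⟨PF.rho0_ofFrac_eq_zero _ _ _ (fun _ _ => Or.inl rfl) hc ?_, PF.rho1_ofFrac_eq_zero _ _ _ hc⟩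
  -- double zero of `N_G = block(0,e)·block(a−e,f)·block(a−f,b)·(t+g−1)` at `t = 1 − m`
  have hcases : (0 ≤ m - 1 ∧ m - 1 < p.e ∧ p.a - p.e ≤ m - 1 ∧ m - 1 < p.f)
      ∨ (0 ≤ m - 1 ∧ m - 1 < p.e ∧ p.a - p.f ≤ m - 1 ∧ m - 1 < p.b)
      ∨ (p.a - p.e ≤ m - 1 ∧ m - 1 < p.f ∧ p.a - p.f ≤ m - 1 ∧ m - 1 < p.b) := by omega
  unfold NfBL
  rcases hcases with ⟨a1, a2, a3, a4⟩ | ⟨a1, a2, a3, a4⟩ | ⟨a1, a2, a3, a4⟩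
  · exact (pow_two (lin (m - 1)) ▸ mul_dvd_mul (lin_dvd_block a1 a2) (lin_dvd_block a3 a4)).mul_right _
      |>.mul_right _
  · refine (pow_two (lin (m - 1)) ▸ mul_dvd_mul (lin_dvd_block a1 a2) (lin_dvd_block a3 a4)).trans ?_
    exact ⟨block (p.a - p.e) p.f * lin (p.g - 1), by ring⟩
  · refine (pow_two (lin (m - 1)) ▸ mul_dvd_mul (lin_dvd_block a1 a2) (lin_dvd_block a3 a4)).trans ?_
    exact ⟨block 0 p.e * lin (p.g - 1), by ring⟩

/-! ### Step (5): node moves -/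

/-- Along `δ_b` (`k ≥ 0`) the own node of `p+kδ` lies left of the common node `s* = node(p)`, and `F_L(p+kδ;·)` has a
double zero at every lattice point in between: `Λ_{node(p+kδ)}[vL(p+kδ)] = Λ_{s*}[vL(p+kδ)]` in both coordinates. -/
theorem lam_nodes_bL (h0 : p.Omega) {k : ℤ} (hk0 : 0 ≤ k) (hk : (p.addB k).Omega) (D : ℕ)
    (hD : (p.addB k).vL.poly.natDegree ≤ D) :
    lam0 D (p.addB k).nodeL (p.addB k).vL = lam0 D p.nodeL (p.addB k).vL ∧
      lam1 (p.addB k).nodeL (p.addB k).vL = lam1 p.nodeL (p.addB k).vL := by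
  have sp := a2star_t1a_eq h0
  have spk := a2star_t1a_eq hk
  simp only [addB_b, addB_e, addB_f] at spk
  obtain ⟨o1, o2, o3, o4, o5, o6, o7, o8, o9⟩ := h0
  have hle : a2star p.t1a ≤ a2star (p.addB k).t1a := by rw [sp, spk]; omega
  have hlo : p.a - max p.e p.f + 1 ≤ a2star p.t1a := by rw [sp]; omega
  obtain ⟨n, hn⟩ : ∃ n : ℕ, a2star (p.addB k).t1a = a2star p.t1a + n :=
    ⟨(a2star (p.addB k).t1a - a2star p.t1a).toNat, by rw [Int.toNat_of_nonneg (sub_nonneg.2 hle)]; ring⟩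
  have hs : p.nodeL = (p.addB k).nodeL + n := by unfold nodeL; rw [hn]; ring
  rw [hs]
  have ha : -(p.addB k).nodeL < (p.addB k).a := by simp only [addB_a]; unfold nodeL; omega
  refine (lam_vL_move hk _ n D hD ha fun i hi => ?_).imp Eq.symm Eq.symm
  refine sq_lin_dvd_num hk ?_ ?_
  · simp only [addB_a, addB_e, addB_f]; unfold nodeL; omega
  · unfold nodeL; omega

/-! ### Step (6): the first-tale recurrence of direction `b` -/

/-- **Direction `b`, first tale.** For `p, p+δ, p+2δ, p+3δ ∈ Ω` (`δ = δ_b`), the first-tale functionals at their own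
nodes satisfy cert-2's telescoper: `Σ_k c^b_k(p)·Λ¹_{node(p+kδ)}[vL(p+kδ)] = 0` and the same for `Λ⁰` with the common
truncation `D = d⁺(p) + 7`. -/
theorem recL_b (h0 : p.Omega) (h1 : (p.addB 1).Omega) (h2 : (p.addB 2).Omega) (h3 : (p.addB 3).Omega) :
    (p.coefB 0 * lam1 p.nodeL p.vL + p.coefB 1 * lam1 (p.addB 1).nodeL (p.addB 1).vL
      + p.coefB 2 * lam1 (p.addB 2).nodeL (p.addB 2).vL + p.coefB 3 * lam1 (p.addB 3).nodeL (p.addB 3).vL = 0) ∧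
    (p.coefB 0 * lam0 (dExp p.t1a p.t1b + 7) p.nodeL p.vL
      + p.coefB 1 * lam0 (dExp p.t1a p.t1b + 7) (p.addB 1).nodeL (p.addB 1).vL
      + p.coefB 2 * lam0 (dExp p.t1a p.t1b + 7) (p.addB 2).nodeL (p.addB 2).vL
      + p.coefB 3 * lam0 (dExp p.t1a p.t1b + 7) (p.addB 3).nodeL (p.addB 3).vL = 0) := by
  set D := dExp p.t1a p.t1b + 7 with hDdef
  have hdata := dataId_bL h0 h1 h2 h3
  have hrho := GfBL_rho h0
  -- degrees
  have hDk : ∀ q : Pt, q.Omega → q.a = p.a → q.e = p.e → q.f = p.f → q.g = p.g → q.b ≤ p.b + 3 →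
      q.vL.poly.natDegree ≤ D := fun q hq qa qe qf qg qb => by
    refine (vL_natDegree_le_w hq).trans ?_
    rw [hDdef]; unfold dExp; rw [sum_t1a_sub_sum_t1b, sum_t1a_sub_sum_t1b]; unfold dInt
    rw [qa, qe, qf, qg]; omega
  have hD1 := hDk _ h1 rfl rfl rfl rfl (by simp)
  have hD2 := hDk _ h2 rfl rfl rfl rfl (by simp)
  have hD3 := hDk _ h3 rfl rfl rfl rfl (by simp)
  have m1 := lam_nodes_bL h0 (by norm_num) h1 D hD1
  have m2 := lam_nodes_bL h0 (by norm_num) h2 D hD2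
  have m3 := lam_nodes_bL h0 (by norm_num) h3 D hD3
  have s1 := lam1_step p.nodeL p.coefB _ p.GfBL hdata
  have s0 := lam0_step D p.nodeL p.coefB _ p.GfBL hdata (natDegree_GfBL_le p h0)
  rw [Fin.sum_univ_four] at s1 s0
  simp only [Matrix.cons_val_zero, Matrix.cons_val_one, Matrix.cons_val_two, Matrix.cons_val_three,
    Matrix.head_cons, Matrix.tail_cons] at s1 s0
  rw [hrho.2] at s1
  rw [hrho.1] at s0
  rw [m1.2, m2.2, m3.2, m1.1, m2.1, m3.1]
  exact ⟨s1, s0⟩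

end Pt

end Summit.KontsevichZagierPeriods.Zeta5Search.TwoTaleOmega

end
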